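import Mathlib.RingTheory.Valuation.ValuationSubring
import Mathlib.RingTheory.LocalRing.ResidueField.Basic
import Mathlib.RingTheory.Adjoin.Basic
import Mathlib.FieldTheory.IntermediateField.Adjoin.Basic
import Mathlib.Algebra.CharP.Lemmas
import HarnessLib

/-!
# Tools for the `α_p`-tower: inverting units of value one on a chart; residues of best approximations

Crux `Valuative.LuAlphaPTorsor` (item `stmt-ResolutionOfSingularities-0641`), line
`pfaff-line-log-final-forms`, reshape v6 (lead seat c4), assembly S6.

* `exists_chart_adjoin_inv` — adjoining the inverse of an element of value `1` to a chart
  `(R, x)` (finitely generated `R ⊆ O`, centre generated by the `xᵢ`) gives a chart `(R[u⁻¹], x)`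
  with the same parameters and the same fraction field.
* `exists_eq_div_pow_of_mem_adjoin_inv` — elements of `R[u⁻¹]` are `r / u^m`.
* `valuation_pow_sub_pow_eq_one_of_bestApprox` — if `c₀ ∈ M` is a best approximation of `t`
  from the subfield `M` and `w (t − c₀)` is a unit of `O` (`w ∈ M`), then in characteristic `p`
  the unit `u = (w (t − c₀))^p` is not congruent to a `p`-th power modulo `𝔪_O`:
  `v(u − c^p) = 1` for every `c ∈ O ∩ M` (the residue of `w(t − c₀)` is not in the residue field
  of `M`, else the approximation could be improved).
-/

set_option linter.dupNamespace false

open IsLocalRing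

namespace Summit.ResolutionOfSingularities.ResolutionOfSingularities.Theorems.PfaffLine

variable {k K : Type} [Field k] [Field K] [Algebra k K]

/-! ### Membership in the centre -/

/-- Membership in the centre `𝔪_O ∩ R` of a subalgebra `R ⊆ O` is `v < 1`. [folklore] -/
theorem mem_centre_iff (O : ValuationSubring K) {R : Subalgebra k K}
    (hRO : R.toSubring ≤ O.toSubring) (r : R.toSubring) :
    r ∈ Ideal.comap (Subring.inclusion hRO) (maximalIdeal O) ↔ O.valuation (r : K) < 1 := by
  rw [Ideal.mem_comap]
  exact ValuationSubring.valuation_lt_one_iff O (Subring.inclusion hRO r)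

/-! ### Elements of `R[u⁻¹]` -/

/-- Every element of `R[u⁻¹]` (`u ∈ R` non-zero) is `r / u^m` with `r ∈ R`. [folklore] -/
theorem exists_eq_div_pow_of_mem_adjoin_inv (R : Subalgebra k K) {u : K} (hu : u ∈ R)
    (hu0 : u ≠ 0) {z : K} (hz : z ∈ Algebra.adjoin k (insert u⁻¹ (R : Set K))) :
    ∃ (r : K) (m : ℕ), r ∈ R ∧ z = r / u ^ m := by
  refine Algebra.adjoin_induction (fun y hy => ?_) (fun c => ?_) (fun a b _ _ ha hb => ?_)
    (fun a b _ _ ha hb => ?_) hz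
  · rcases Set.mem_insert_iff.mp hy with rfl | hy
    · exact ⟨1, 1, R.one_mem, by simp⟩
    · exact ⟨y, 0, hy, by simp⟩
  · exact ⟨algebraMap k K c, 0, R.algebraMap_mem c, by simp⟩
  · obtain ⟨r, m, hr, rfl⟩ := ha
    obtain ⟨r', m', hr', rfl⟩ := hb
    refine ⟨r * u ^ m' + r' * u ^ m, m + m', R.add_mem (R.mul_mem hr (R.pow_mem hu _))
      (R.mul_mem hr' (R.pow_mem hu _)), ?_⟩
    rw [div_add_div _ _ (pow_ne_zero _ hu0) (pow_ne_zero _ hu0), pow_add]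
    ring
  · obtain ⟨r, m, hr, rfl⟩ := ha
    obtain ⟨r', m', hr', rfl⟩ := hb
    refine ⟨r * r', m + m', R.mul_mem hr hr', ?_⟩
    rw [div_mul_div_comm, pow_add]

/-- **Inverting an element of value `1` on a chart.** If `(R, x)` is a chart (`R ⊆ O` finitely
generated, centre generated by the `xᵢ ∈ R`) and `u ∈ R` has `v(u) = 1`, then `R' = R[u⁻¹]` is
again a chart with the same parameters: `R ≤ R' ⊆ Frac R`, `u⁻¹ ∈ R'`, `R' ⊆ O`, and the centre
of `R'` is generated by the `xᵢ`. [folklore] -/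
theorem exists_chart_adjoin_inv (O : ValuationSubring K) {n : ℕ} (R : Subalgebra k K)
    (hRO : R.toSubring ≤ O.toSubring) (x : Fin n → K) (hx : ∀ i, x i ∈ R) (hfg : R.FG)
    (hspan : Ideal.span (Set.range fun i => (⟨x i, hx i⟩ : R.toSubring)) =
      Ideal.comap (Subring.inclusion hRO) (maximalIdeal O))
    {u : K} (hu : u ∈ R) (hu1 : O.valuation u = 1) :
    ∃ (R' : Subalgebra k K) (hR'O : R'.toSubring ≤ O.toSubring) (hx' : ∀ i, x i ∈ R'),
      R ≤ R' ∧ u⁻¹ ∈ R' ∧ R'.FG ∧ ((R' : Set K) ⊆ Subfield.closure (R : Set K)) ∧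
      Ideal.span (Set.range fun i => (⟨x i, hx' i⟩ : R'.toSubring)) =
        Ideal.comap (Subring.inclusion hR'O) (maximalIdeal O) := by
  classical
  have hu0 : u ≠ 0 := fun h => by rw [h, map_zero] at hu1; exact zero_ne_one hu1
  have huinvO : u⁻¹ ∈ O := by
    rw [← O.valuation_le_one_iff, map_inv₀, hu1, inv_one]
  set R' : Subalgebra k K := Algebra.adjoin k (insert u⁻¹ (R : Set K)) with hR'
  have hRR' : R ≤ R' := fun z hz => Algebra.subset_adjoin (Set.mem_insert_of_mem _ hz)
  have huR' : u⁻¹ ∈ R' := Algebra.subset_adjoin (Set.mem_insert _ _)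
  have hR'O : R'.toSubring ≤ O.toSubring := by
    let O' : Subalgebra k K :=
      { O.toSubring.toSubsemiring with
        algebraMap_mem' := fun c => hRO (R.algebraMap_mem c) }
    change R' ≤ O'
    rw [hR', Algebra.adjoin_le_iff]
    rintro z hz
    rcases Set.mem_insert_iff.mp hz with rfl | hz
    · exact huinvO
    · exact hRO hz
  have hx' : ∀ i, x i ∈ R' := fun i => hRR' (hx i)
  refine ⟨R', hR'O, hx', hRR', huR', ?_, ?_, ?_⟩
  · -- finitely generated
    obtain ⟨s, hs⟩ := hfg
    refine ⟨insert u⁻¹ s, ?_⟩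
    rw [Finset.coe_insert, hR', ← hs]
    apply le_antisymm
    · exact Algebra.adjoin_mono (Set.insert_subset_insert Algebra.subset_adjoin)
    · rw [Algebra.adjoin_le_iff]
      rintro z hz
      rcases Set.mem_insert_iff.mp hz with rfl | hz
      · exact Algebra.subset_adjoin (Set.mem_insert _ _)
      · exact Algebra.adjoin_mono (Set.subset_insert _ _) hz
  · -- inside the fraction field of `R`
    intro z hz
    obtain ⟨r, m, hr, rfl⟩ := exists_eq_div_pow_of_mem_adjoin_inv R hu hu0 hz
    exact div_mem (Subfield.subset_closure hr) (pow_mem (Subfield.subset_closure hu) _)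
  · -- the centre of `R'` is generated by the `xᵢ`
    apply le_antisymm
    · rw [Ideal.span_le]
      rintro _ ⟨i, rfl⟩
      have hi : (⟨x i, hx i⟩ : R.toSubring) ∈ Ideal.span (Set.range fun i => (⟨x i, hx i⟩ : R.toSubring)) :=
        Ideal.subset_span ⟨i, rfl⟩
      rw [hspan, Ideal.mem_comap] at hi
      change Subring.inclusion hR'O ⟨x i, hx' i⟩ ∈ maximalIdeal O
      exact hi
    · intro z hz
      rw [Ideal.mem_comap] at hz
      have hvz : O.valuation (z : K) < 1 := (ValuationSubring.valuation_lt_one_iff O _).mp hz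
      obtain ⟨r, m, hr, hzr⟩ := exists_eq_div_pow_of_mem_adjoin_inv R hu hu0 z.2
      have hvr : O.valuation r < 1 := by
        have h1 : O.valuation (z : K) = O.valuation r := by
          rw [hzr, map_div₀, map_pow, hu1, one_pow, div_one]
        rwa [h1] at hvz
      have hrc : (⟨r, hr⟩ : R.toSubring) ∈ Ideal.comap (Subring.inclusion hRO) (maximalIdeal O) := by
        rw [Ideal.mem_comap]
        exact (ValuationSubring.valuation_lt_one_iff O _).mpr hvr
      rw [← hspan] at hrc
      -- push the span membership along `R → R'` and multiply by the unit power
      have hmap : Ideal.map (Subring.inclusion (show R.toSubring ≤ R'.toSubring from hRR'))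
          (Ideal.span (Set.range fun i => (⟨x i, hx i⟩ : R.toSubring))) ≤
          Ideal.span (Set.range fun i => (⟨x i, hx' i⟩ : R'.toSubring)) := by
        rw [Ideal.map_span, Ideal.span_le]
        rintro _ ⟨_, ⟨i, rfl⟩, rfl⟩
        exact Ideal.subset_span ⟨i, rfl⟩
      have hrR' : (⟨r, hRR' hr⟩ : R'.toSubring) ∈
          Ideal.span (Set.range fun i => (⟨x i, hx' i⟩ : R'.toSubring)) :=
        hmap (Ideal.mem_map_of_mem _ hrc)
      have hzeq : z = ⟨r, hRR' hr⟩ * ⟨u⁻¹ ^ m, R'.pow_mem huR' m⟩ := by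
        apply Subtype.ext
        change (z : K) = r * u⁻¹ ^ m
        rw [hzr, div_eq_mul_inv, inv_pow]
      rw [hzeq]
      exact Ideal.mul_mem_right _ _ hrR'

/-! ### Residues of best approximations -/

/-- **A best approximation which is a unit after scaling has a residue of degree `p`.** Let `M`
be a subfield of `K`, `t ∈ K`, `c₀ ∈ M` with `v(t − c₀) ≤ v(t − c)` for all `c ∈ M`, and `w ∈ M`
with `v(w (t − c₀)) = 1`. Then `v(w(t − c₀) − c) = 1` for every `c ∈ O ∩ M` (were it `< 1`,
`c₀ + c/w ∈ M` would be a better approximation), hence in characteristic `p`: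
`v((w (t − c₀))^p − c^p) = 1` for every `c ∈ O ∩ M`. [folklore] -/
theorem valuation_pow_sub_pow_eq_one_of_bestApprox {p : ℕ} [Fact p.Prime] [CharP K p]
    (O : ValuationSubring K) (M : IntermediateField k K) {t c₀ w : K} (hc₀ : c₀ ∈ M) (hw : w ∈ M)
    (hbest : ∀ c : K, c ∈ M → O.valuation (t - c₀) ≤ O.valuation (t - c))
    (hunit : O.valuation (w * (t - c₀)) = 1) :
    ∀ c : K, c ∈ O → c ∈ M → O.valuation ((w * (t - c₀)) ^ p - c ^ p) = 1 := by
  intro c hcO hcM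
  have hw0 : w ≠ 0 := fun h => by
    rw [h, zero_mul, map_zero] at hunit
    exact zero_ne_one hunit
  have hvw : O.valuation w ≠ 0 := (map_ne_zero _).mpr hw0
  -- `v(w (t − c₀) − c) = 1`
  have h1 : O.valuation (w * (t - c₀) - c) = 1 := by
    have hle : O.valuation (w * (t - c₀) - c) ≤ 1 := by
      have hc1 : O.valuation c ≤ 1 := (O.valuation_le_one_iff c).mpr hcO
      refine le_trans (Valuation.map_sub _ _ _) (max_le (le_of_eq hunit) hc1)
    rcases hle.lt_or_eq with hlt | heq
    · exfalso
      -- `c₀ + c/w` is a better approximation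
      have hfac : w * (t - c₀) - c = w * (t - (c₀ + c / w)) := by
        field_simp
        ring
      have hbetter := hbest (c₀ + c / w) (add_mem hc₀ (div_mem hcM hw))
      rw [hfac, map_mul] at hlt
      -- `v(w) v(t - c₀) = 1`
      rw [map_mul] at hunit
      have hlt' : O.valuation w * O.valuation (t - (c₀ + c / w)) <
          O.valuation w * O.valuation (t - c₀) := by rw [hunit]; exact hlt
      exact absurd hbetter (not_le.mpr (lt_of_mul_lt_mul_left' hlt'))
    · exact heq
  rw [← sub_pow_char (w * (t - c₀)) c, map_pow, h1, one_pow]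

/-- **Inverting an element of value `1` on a chart** (registered sub-goal form of
`exists_chart_adjoin_inv`, binders explicit). [folklore] -/
theorem chart_adjoin_inv :
    ∀ (k K : Type) [Field k] [Field K] [Algebra k K] (O : ValuationSubring K) (n : ℕ) (R : Subalgebra k K) (hRO : R.toSubring ≤ O.toSubring) (x : Fin n → K) (hx : ∀ i, x i ∈ R), R.FG → Ideal.span (Set.range fun i => (⟨x i, hx i⟩ : R.toSubring)) = Ideal.comap (Subring.inclusion hRO) (IsLocalRing.maximalIdeal O) → ∀ (u : K), u ∈ R → O.valuation u = 1 → ∃ (R' : Subalgebra k K) (hR'O : R'.toSubring ≤ O.toSubring) (hx' : ∀ i, x i ∈ R'), R ≤ R' ∧ u⁻¹ ∈ R' ∧ R'.FG ∧ ((R' : Set K) ⊆ Subfield.closure (R : Set K)) ∧ Ideal.span (Set.range fun i => (⟨x i, hx' i⟩ : R'.toSubring)) = Ideal.comap (Subring.inclusion hR'O) (IsLocalRing.maximalIdeal O) := by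
  intro k K _ _ _ O n R hRO x hx hfg hspan u hu hu1
  exact exists_chart_adjoin_inv O R hRO x hx hfg hspan hu hu1

end Summit.ResolutionOfSingularities.ResolutionOfSingularities.Theorems.PfaffLine
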